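import Summits.BirchSwinnertonDyer.BirchSwinnertonDyer.Theorems.PrintCf2SplitBadTwoCMPrimaryDyadicValue
import HarnessLib

/-!
# Crux `PrintCf2.SplitBadTwoRankOneOfFacts` (stmt-BirchSwinnertonDyer-20368), road α v10.3 — brick B15 file 16: THE PINNING CLAUSE IS UNIFORM —
# an element acting pointwise by `±1` on a group acts as `+1` on all of it or as `−1` on all of it (input (T3, `w = v`) of the (C3-ψ) programme)

Cell `bsd-print-cf2`, width seat `bsd-line-cf2-p1-w2` g9 (prover-bsd-line-cf2-p1-w2-g9-0); brick B15 (memo `Cruxes/SplitBadTwoRankOneOfFacts/B15-DYADIC-EXACT-w2g9.md`,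
addendum 9 (T3)); `--supports stmt-BirchSwinnertonDyer-20368` (helper, Theses-free). HONEST FRAMING: nothing here closes the crux or a registered stub; BSD
is not proved by any of this; no summit statement is proved by this seat. No definition, no named fact, no `sorry`.

WHAT. The S3c pinning clause is stated POINTWISE: `∀ τ ∈ I_v, ∀ x : W*, τ • x = x ∨ τ • x = −x`. Since a group is never the union of two proper subgroups,
it is automatically UNIFORM: each `τ ∈ I_v` acts as `+1` on all of `W*` or as `−1` on all of `W*` — i.e. `ψ_{W*}(I_v) ⊆ {±1}`, the `w = v` clause of
(T3) in the construction of the `ℤ₂`-line `ψ_{W*} mod ±1` ((C3-ψ), memo addendum 9), with no appeal to the scalar structure of `W*`: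
* `forall_smul_eq_or_forall_smul_eq_neg_of_pointwise` — generic, any `DistribMulAction`;
* **`pinningClause_uniform`** — the clause for `W* = ↥(endEigenPrimaryTorsion 2 π r)` in the frame's exact shape.
presearch: folklore («a group is not a union of two proper subgroups»); no fact filed. beyond-print theorem: no.

References: [Rubin1999] §3 Lemma 3.6 (ii); [Agboola2007] §3.
-/

noncomputable section

open scoped Classical

set_option linter.dupNamespace false
set_option autoImplicit false

namespace Summit.BirchSwinnertonDyer.BirchSwinnertonDyer.Theorems.PrintCf2.CMPrimes

open WeierstrassCurve Literature.NumberTheory.EllipticCurves Literature.NumberTheory.GaloisRepresentations Field NumberField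

/-- **Pointwise `±1` is uniform `±1`**: if `g • x ∈ {x, −x}` for every `x` in a commutative group, then `g` acts as `+1` on everything or as `−1` on
everything (the fixed and anti-fixed subgroups cannot both be proper). [folklore] -/
theorem forall_smul_eq_or_forall_smul_eq_neg_of_pointwise {G M : Type*} [Monoid G] [AddCommGroup M] [DistribMulAction G M] (g : G)
    (h : ∀ x : M, g • x = x ∨ g • x = -x) : (∀ x : M, g • x = x) ∨ (∀ x : M, g • x = -x) := by
  by_contra hcon
  push Not at hcon
  obtain ⟨⟨a, ha⟩, ⟨b, hb⟩⟩ := hcon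
  have ha' : g • a = -a := (h a).resolve_left ha
  have hb' : g • b = b := (h b).resolve_right hb
  rcases h (a + b) with hab | hab
  · rw [smul_add, ha', hb', add_left_inj] at hab
    -- `-a = a`, so `g • a = -a = a`
    exact ha (by rw [ha', hab])
  · rw [smul_add, ha', hb', neg_add, add_right_inj] at hab
    -- `b = -b`, so `g • b = b = -b`
    exact hb (by rw [hb', ← hab])

/-- **The S3c pinning clause is uniform**: on a frame, every `τ ∈ I_v` acts on `W* = E[𝔮_r^∞]` as `+1` on all of `W*` or as `−1` on all of `W*`
(`ψ_{W*}(I_v) ⊆ {±1}`). Works for any subgroup `I` and any Galois-stable summand given as `endEigenPrimaryTorsion`. [folklore] -/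
theorem pinningClause_uniform {K : Type} [Field K] [NumberField K] (W : WeierstrassCurve ℚ) [W.IsElliptic]
    (π : (W.baseChange K).endRing) (r : ℤ_[2]) (I : Subgroup (absoluteGaloisGroup K))
    (hclause : ∀ τ ∈ I, ∀ x : ↥((W.baseChange K).endEigenPrimaryTorsion 2 π r), τ • x = x ∨ τ • x = -x) :
    ∀ τ ∈ I, (∀ x : ↥((W.baseChange K).endEigenPrimaryTorsion 2 π r), τ • x = x) ∨
      (∀ x : ↥((W.baseChange K).endEigenPrimaryTorsion 2 π r), τ • x = -x) := by
  intro τ hτ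
  by_contra hcon
  push Not at hcon
  obtain ⟨⟨a, ha⟩, ⟨b, hb⟩⟩ := hcon
  have ha' : τ • a = -a := (hclause τ hτ a).resolve_left ha
  have hb' : τ • b = b := (hclause τ hτ b).resolve_right hb
  -- pass to the ambient group, where the action is distributive
  have hav : τ • (a : (W.baseChange K).geomPrimaryTorsion 2) = -(a : (W.baseChange K).geomPrimaryTorsion 2) := congrArg Subtype.val ha'
  have hbv : τ • (b : (W.baseChange K).geomPrimaryTorsion 2) = (b : (W.baseChange K).geomPrimaryTorsion 2) := congrArg Subtype.val hb'
  rcases hclause τ hτ (a + b) with hab | hab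
  · have h := congrArg Subtype.val hab
    change τ • ((a : (W.baseChange K).geomPrimaryTorsion 2) + b) = (a : (W.baseChange K).geomPrimaryTorsion 2) + b at h
    rw [smul_add, hav, hbv, add_left_inj] at h
    exact ha (Subtype.ext (by change τ • (a : (W.baseChange K).geomPrimaryTorsion 2) = a; rw [hav, h]))
  · have h := congrArg Subtype.val hab
    change τ • ((a : (W.baseChange K).geomPrimaryTorsion 2) + b) = -((a : (W.baseChange K).geomPrimaryTorsion 2) + b) at h
    rw [smul_add, hav, hbv, neg_add, add_right_inj] at h
    exact hb (Subtype.ext (by change τ • (b : (W.baseChange K).geomPrimaryTorsion 2) = -b; rw [hbv, ← h]))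

end Summit.BirchSwinnertonDyer.BirchSwinnertonDyer.Theorems.PrintCf2.CMPrimes

end
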